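import Literature.NumberTheory.Sieve.AsymptoticSieveForPrimesTheorem2Level
import Literature.NumberTheory.Sieve.AsymptoticSieveForPrimesTheorem2Inputs
import Literature.NumberTheory.Sieve.AsymptoticSieveForPrimesTyz
import HarnessLib

/-!
# Asymptotic sieve for primes, Theorem 2: (9.7) and (9.12) — the level of distribution of `μ²a` and its counting function, with FI's parameters

Topic `Literature/NumberTheory/Sieve` (trunk T-SIEVE), sequel of `…Theorem2Level` and `…Theorem2Inputs`.
Source: J. Friedlander, H. Iwaniec, *Asymptotic sieve for primes*, Ann. of Math. 148 (1998) 1041–1065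
[FriedlanderIwaniecASP1998] (= arXiv:math/9811186), §9 pp. 1061–1062: (9.7)
`∑♭_{d≤D} |r̃_d(t)| ≤ Ã(x)(log x)^{-2^{22}}` from (R₃) (level `DL²`, saving `L⁻²`, `L = (log x)^{2^{24}}`),
(9.2), (1.6), (1.9), and (9.12) `Ã(x) = G A(x){1 + O((log x)⁻¹)}` ("Gathering the above estimates we
conclude the proof of (9.7), but with `A(x)` in place of `Ã(x)` (actually we saved at least a factor
`log x` …). Note, however, that along the above lines we have, by (9.10), also proved (9.12)").

* `SieveSequence.moebiusSq_level_eventually` — for a sifted sequence with `size_eq`, (2.2), (2.4), (2.6),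
  (2.7), (2.8), (2.10) and the cubefree level hypothesis (2.9) of [FriedlanderIwaniecAnnals1998]
  Proposition 2.1 (= (9.2), (9.1), (1.9), (1.6), (R1), (R₃) of [FriedlanderIwaniecASP1998]): for all large
  `x` and all `t ≤ x`,
  `∑_{d ≤ D(x) sqfree} |r̃_d(t)| ≤ 2e^{c'} A(x)(log x)^{-2^{22}-1}` and
  `|Ã(t) - G_{⌊x⌋} A(t)| ≤ A(x)(log x)^{-2^{22}-2}` (`c' = |c| + |K₉|(log 2)^{-10}` from (2.7),
  `G_Y = ∏_{p≤Y}(1 - g(p²))`). The proof inserts FI's parameters `Λ = ⌊L⌋`, `Λ₁ = ⌊L√D⌋`,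
  `M = ⌊DL²⌋` into `moebiusSq_levelSum_le_struct` / `moebiusSq_E_le` (`…Theorem2Level`) and checks the
  four resulting powers of `log x` against `(log x)^{-2^{22}-2}` (density tail `(log x)^{1-3·2^{22}}`,
  `E₁`: `(log x)^{2^{20}-2^{24}}`, `E₂₂`: `(log x)^{2^{17}-3·2^{21}}`, `E₂₁`: `(log x)^{16-2^{23}}`, up to
  constants absorbed by one more power of `log x`).

## References

* J. Friedlander, H. Iwaniec, *Asymptotic sieve for primes*, Ann. of Math. 148 (1998), 1041–1065,
  §9 (9.7)–(9.12), pp. 1061–1062. [cite: FriedlanderIwaniecASP1998, §9 (9.7)-(9.12)]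

## Mathlib / tree search

Tree: `moebiusSq_levelSum_le_struct`, `moebiusSq_size_sub_le_struct`, `moebiusSq_E_le`
(`…Theorem2Level`), `sum_a_mul_two_pow_card_primeFactors_le`, `sum_cubefree_pow_mul_density_le`,
`prod_one_add_density_le_exp` (`…Theorem2Counting`), `sum_squarefree_density_le_exp`,
`sum_squarefree_moebiusSqDensity_le` (`…Theorem2Tails`), `exists_sum_sigma_zero_pow_div_le(_real)`
(`DivisorPowerSums`), `sum_primesLE_inv_sq_le_one` (`FriedlanderIwaniecPrimesProp21`), `sum_primesLE_density_le` (`…Tyz`). Mathlib: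
`Real.isLittleO_pow_log_id_atTop`, `tendsto_rpow_atTop`. `lean search 'moebiusSq_level_eventually'`:
nothing before this file.
-/

noncomputable section

open Filter Finset Real Asymptotics
open scoped ArithmeticFunction.sigma

namespace Literature.NumberTheory.Sieve

open FriedlanderIwaniecPrimesSquarefree FriedlanderIwaniecPrimes

/-! ### Comparing powers of `log x` -/

/-- `κ ℒ^a / ℒ^b ≤ 1/ℒ^c` when `1 ≤ ℒ`, `κ ≤ ℒ` and `a + c + 1 ≤ b`. [folklore] -/
theorem const_mul_pow_div_pow_le {ℒ κ : ℝ} (hℒ : 1 ≤ ℒ) (hκ : κ ≤ ℒ) {a b c : ℕ}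
    (h : a + c + 1 ≤ b) : κ * ℒ ^ a / ℒ ^ b ≤ 1 / ℒ ^ c := by
  have hℒ0 : 0 < ℒ := by linarith
  rw [div_le_div_iff₀ (pow_pos hℒ0 b) (pow_pos hℒ0 c), one_mul]
  calc κ * ℒ ^ a * ℒ ^ c ≤ ℒ * ℒ ^ a * ℒ ^ c := by gcongr
    _ = ℒ ^ (a + c + 1) := by ring
    _ ≤ ℒ ^ b := pow_le_pow_right₀ hℒ h

/-- `(ℒ^{2^24})^{3/4} = ℒ^{3·2^22}` for `ℒ ≥ 0`. [folklore] -/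
theorem rpow_three_quarters_pow (ℒ : ℝ) (hℒ : 0 ≤ ℒ) :
    (ℒ ^ (2 ^ 24 : ℕ)) ^ (3 / 4 : ℝ) = ℒ ^ (3 * 2 ^ 22 : ℕ) := by
  rw [← Real.rpow_natCast ℒ (2 ^ 24), ← Real.rpow_mul hℒ, ← Real.rpow_natCast ℒ (3 * 2 ^ 22)]
  norm_num

namespace SieveSequence

variable (A : SieveSequence)

set_option maxHeartbeats 800000 in -- one `filter_upwards` carrying ~60 local facts and four long `calc` chains
/-- **(9.7) and (9.12) for a general sequence** (FI pp. 1061–1062, with FI's parameters `L = (log x)^{2^{24}}`,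
truncation at `ℓ ≤ L`, `Λ₁ = L√D`): under `size_eq`, (2.2) (constant `c₂`), (2.4), (2.6) (`K`), (2.7)
(`c, K₉`), (2.8) (`K₈`), (2.10) and (2.9) of [FriedlanderIwaniecAnnals1998] Proposition 2.1, for all
sufficiently large `x` and every `t ≤ x`:
`∑_{d ≤ D(x), d sqfree} |r̃_d(t)| ≤ 2 e^{|c| + |K₉|(log 2)^{-10}} A(x) (log x)^{-2^{22}-1}` and
`|Ã(t) - (∏_{p≤⌊x⌋}(1-g(p²))) A(t)| ≤ A(x)(log x)^{-2^{22}-2}`.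
[cite: FriedlanderIwaniecASP1998, §9 (9.7) and (9.12)] -/
theorem moebiusSq_level_eventually (D : ℝ → ℝ) (hsize : ∀ t, A.size t = A.congrSum 1 t)
    {c₂ : ℝ} (hc₂ : 0 < c₂)
    (h22 : ∀ᶠ x : ℝ in atTop,
      c₂ * x ^ (1 / 3 : ℝ) * Real.sqrt (∑ n ∈ Icc 1 ⌊x⌋₊, A.a n ^ 2) ≤ A.size x)
    (h24 : ∀ p : ℕ, p.Prime → 0 ≤ A.density (p ^ 2) ∧ A.density (p ^ 2) ≤ A.density p ∧
      A.density p < 1)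
    {K : ℝ} (h26 : ∀ p : ℕ, p.Prime → A.density (p ^ 2) ≤ K / (p : ℝ) ^ 2) {c K₉ : ℝ}
    (h27 : ∀ y : ℝ, 2 ≤ y →
      |(∑ p ∈ Nat.primesLE ⌊y⌋₊, A.density p) - (Real.log (Real.log y) + c)| ≤ K₉ / Real.log y ^ 10)
    {K₈ : ℝ} (h28 : ∀ᶠ x : ℝ in atTop, ∀ d : ℕ, 1 ≤ d → (d : ℝ) ≤ x ^ (1 / 3 : ℝ) →
      A.congrSum d x ≤ K₈ * (σ 0 d : ℝ) ^ 8 / d * A.size x)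
    (hR1 : ∀ᶠ x : ℝ in atTop, x ^ (2 / 3 : ℝ) < D x ∧ D x < x)
    (h29 : ∀ᶠ x : ℝ in atTop, ∀ t : ℝ, t ≤ x →
      ∑ d ∈ (Icc 1 ⌊D x * (Real.log x ^ (2 ^ 24 : ℕ)) ^ 2⌋₊).filter IsCubefree, |A.remainder d t| ≤
        A.size x / (Real.log x ^ (2 ^ 24 : ℕ)) ^ 2) :
    ∀ᶠ x : ℝ in atTop, ∀ t : ℝ, t ≤ x →
      ∑ d ∈ (Icc 1 ⌊D x⌋₊).filter Squarefree, |A.moebiusSq.remainder d t| ≤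
          2 * Real.exp (|c| + |K₉| / Real.log 2 ^ 10) * A.size x / Real.log x ^ (2 ^ 22 + 1) ∧
        |A.moebiusSq.size t - sqProd A.density ⌊x⌋₊ * A.size t| ≤
          A.size x / Real.log x ^ (2 ^ 22 + 2) := by
  classical
  set g := A.density with hg
  have hgm : g.IsMultiplicative := A.density_mult
  have hK := hyp26_const_nonneg h24 h26
  -- divisor-sum constants
  obtain ⟨C₃, hC₃, hV3⟩ := exists_sum_sigma_zero_pow_div_le 3
  obtain ⟨C₁₇, hC₁₇, hV17⟩ := exists_sum_sigma_zero_pow_div_le_real 17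
  obtain ⟨C₂₀, hC₂₀, hV20⟩ := exists_sum_sigma_zero_pow_div_le_real 20
  set c' : ℝ := |c| + |K₉| / Real.log 2 ^ 10 with hc'
  have hc'0 : 0 ≤ c' := by positivity
  set C₅ : ℝ := ∑' n : ℕ, (n : ℝ) ^ (-(5 / 4 : ℝ)) with hC₅
  have hC₅0 : 0 ≤ C₅ := tsum_nonneg fun n => by positivity
  set K₈' : ℝ := max K₈ 0 with hK₈'
  have hK₈'0 : 0 ≤ K₈' := le_max_right _ _
  -- the constants of the four terms
  set κ₁ : ℝ := 8 * Real.exp (2 * K * C₅ + c') with hκ₁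
  set κ₂ : ℝ := 16 * (256 * K₈' * C₂₀ + 16 * Real.exp (4 * c' + 4 * K)) with hκ₂
  set κ₃ : ℝ := 16 * ((2 * Real.exp (K * C₅) + 1) * (64 * K₈' * C₁₇)) with hκ₃
  set κ₄ : ℝ := 16 * (2 * (C₃ + 1) ^ 2 / c₂ ^ 2) with hκ₄
  -- eventual conditions
  have hlog : Tendsto (fun x : ℝ => Real.log x) atTop atTop := Real.tendsto_log_atTop
  have hL2x : ∀ᶠ x : ℝ in atTop, (Real.log x ^ (2 ^ 24 : ℕ)) ^ 2 ≤ x := by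
    have h := (Real.isLittleO_pow_log_id_atTop (n := 2 ^ 25)).bound (by norm_num : (0 : ℝ) < 1)
    filter_upwards [h, eventually_ge_atTop (1 : ℝ)] with x hx hx1
    rw [one_mul, id, Real.norm_of_nonneg (pow_nonneg (Real.log_nonneg hx1) _),
      Real.norm_of_nonneg (by linarith)] at hx
    calc (Real.log x ^ (2 ^ 24 : ℕ)) ^ 2 = Real.log x ^ (2 ^ 25 : ℕ) := by rw [← pow_mul]; norm_num
      _ ≤ x := hx
  have hx3 : ∀ᶠ x : ℝ in atTop, (2 : ℝ) ≤ x ^ (1 / 3 : ℝ) :=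
    (tendsto_rpow_atTop (by norm_num : (0 : ℝ) < 1 / 3)).eventually_ge_atTop 2
  filter_upwards [h22, h28, hR1, h29, hL2x, hx3, eventually_ge_atTop (8 : ℝ),
    hlog.eventually_ge_atTop (2 : ℝ), hlog.eventually_ge_atTop κ₁, hlog.eventually_ge_atTop κ₂,
    hlog.eventually_ge_atTop κ₃, hlog.eventually_ge_atTop κ₄]
    with x h22x h28x hR1x h29x hL2x' hx3' hx8 hℒ2 hℒκ₁ hℒκ₂ hℒκ₃ hℒκ₄
  intro t htx
  -- basics at `x`
  have hx1 : (1 : ℝ) ≤ x := by linarith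
  have hx0 : (0 : ℝ) < x := by linarith
  set ℒ := Real.log x with hℒ
  have hℒ1 : 1 ≤ ℒ := by linarith
  have hℒ0 : 0 < ℒ := by linarith
  set 𝒜 := A.size x with h𝒜
  have h𝒜eq : 𝒜 = A.congrSum 1 x := hsize x
  have h𝒜0 : 0 ≤ 𝒜 := by rw [h𝒜eq]; exact A.congrSum_nonneg 1 x
  set L := ℒ ^ (2 ^ 24 : ℕ) with hLdef
  have hL1 : 1 ≤ L := one_le_pow₀ hℒ1
  have hℒL : ℒ ≤ L := le_self_pow₀ hℒ1 (by norm_num)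
  have hL2 : 2 ≤ L := hℒ2.trans hℒL
  have hL0 : 0 < L := by linarith
  have hL2eq : L ^ 2 = ℒ ^ (2 ^ 25 : ℕ) := by rw [hLdef, ← pow_mul]; norm_num
  have hL34 : L ^ (3 / 4 : ℝ) = ℒ ^ (3 * 2 ^ 22 : ℕ) := rpow_three_quarters_pow ℒ hℒ0.le
  set X := ⌊x⌋₊ with hX
  have hX1 : 1 ≤ X := Nat.le_floor (by simpa using hx1)
  -- the level `D`
  have hD23 : x ^ (2 / 3 : ℝ) < D x := hR1x.1
  have hDx : D x < x := hR1x.2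
  have hx23 : (4 : ℝ) ≤ x ^ (2 / 3 : ℝ) := by
    calc (4 : ℝ) = 2 ^ (2 : ℕ) := by norm_num
      _ ≤ (x ^ (1 / 3 : ℝ)) ^ (2 : ℕ) := pow_le_pow_left₀ (by norm_num) hx3' 2
      _ = x ^ (2 / 3 : ℝ) := by rw [← Real.rpow_natCast, ← Real.rpow_mul hx0.le]; norm_num
  have hD2 : (2 : ℝ) ≤ D x := by linarith
  have hD0 : 0 < D x := by linarith
  set D₀ := ⌊D x⌋₊ with hD₀def
  have hD₀2 : 2 ≤ D₀ := Nat.le_floor (by exact_mod_cast hD2)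
  have hD₀1 : 1 ≤ D₀ := by omega
  have hD₀X : D₀ ≤ X := Nat.floor_mono hDx.le
  have hD₀le : (D₀ : ℝ) ≤ D x := Nat.floor_le hD0.le
  have hD₀x : (D₀ : ℝ) ≤ x := hD₀le.trans hDx.le
  -- `√D ≥ x^{1/3}`
  have hsD : x ^ (1 / 3 : ℝ) ≤ Real.sqrt (D x) := by
    rw [Real.le_sqrt (by positivity) hD0.le, ← Real.rpow_natCast, ← Real.rpow_mul hx0.le]
    norm_num; exact hD23.le
  have hsD1 : 1 ≤ Real.sqrt (D x) := le_trans (by linarith) hsD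
  -- the parameters `Λ`, `Λ₁`, `M`
  set Λ := ⌊L⌋₊ with hΛdef
  have hΛ1 : 1 ≤ Λ := Nat.le_floor (by exact_mod_cast hL1)
  have hΛle : (Λ : ℝ) ≤ L := Nat.floor_le hL0.le
  have hΛge : L / 2 ≤ Λ := by
    have := Nat.sub_one_lt_floor L; rw [← hΛdef] at this; linarith
  have hΛ0 : (0 : ℝ) < Λ := by exact_mod_cast hΛ1
  set Λ₁ := ⌊L * Real.sqrt (D x)⌋₊ with hΛ₁def
  have hLsD : L * x ^ (1 / 3 : ℝ) ≤ L * Real.sqrt (D x) := mul_le_mul_of_nonneg_left hsD hL0.le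
  have hLsD2 : (2 : ℝ) ≤ L * Real.sqrt (D x) := by nlinarith
  have hΛ₁1 : 1 ≤ Λ₁ := Nat.le_floor (by push_cast; linarith)
  have hΛ₁le : (Λ₁ : ℝ) ≤ L * Real.sqrt (D x) := Nat.floor_le (by positivity)
  have hΛ₁ge : L * x ^ (1 / 3 : ℝ) / 2 ≤ Λ₁ := by
    have := Nat.sub_one_lt_floor (L * Real.sqrt (D x)); rw [← hΛ₁def] at this; linarith
  have hΛ₁0 : (0 : ℝ) < Λ₁ := by exact_mod_cast hΛ₁1
  set M := ⌊D x * L ^ 2⌋₊ with hMdef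
  have hM : D₀ * Λ ^ 2 ≤ M := by
    refine Nat.le_floor ?_
    push_cast
    exact mul_le_mul hD₀le (pow_le_pow_left₀ (Nat.cast_nonneg _) hΛle 2) (by positivity) hD0.le
  have hM₁ : Λ₁ ^ 2 ≤ M := by
    refine Nat.le_floor ?_
    push_cast
    calc (Λ₁ : ℝ) ^ 2 ≤ (L * Real.sqrt (D x)) ^ 2 := pow_le_pow_left₀ (Nat.cast_nonneg _) hΛ₁le 2
      _ = D x * L ^ 2 := by rw [mul_pow, Real.sq_sqrt hD0.le]; ring
  have hM2 : 2 ≤ M := le_trans (by nlinarith [hD₀2, hΛ1] : 2 ≤ D₀ * Λ ^ 2) hM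
  have hMx2 : (M : ℝ) ≤ x ^ 2 := by
    calc (M : ℝ) ≤ D x * L ^ 2 := Nat.floor_le (by positivity)
      _ ≤ x * x := mul_le_mul hDx.le hL2x' (by positivity) hx0.le
      _ = x ^ 2 := (sq x).symm
  -- the level hypothesis at `t` and at `x`
  have hRt := h29x t htx
  have hRx := h29x x le_rfl
  -- (2.8) with a nonnegative constant
  have h28x' : ∀ d : ℕ, 1 ≤ d → (d : ℝ) ≤ x ^ (1 / 3 : ℝ) →
      A.congrSum d x ≤ K₈' * (σ 0 d : ℝ) ^ 8 / d * A.size x := fun d hd hdx =>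
    (h28x d hd hdx).trans (mul_le_mul_of_nonneg_right
      (div_le_div_of_nonneg_right (mul_le_mul_of_nonneg_right (le_max_left _ _) (by positivity))
        (Nat.cast_nonneg _)) h𝒜0)
  -- the divisor sums `V₁₇`, `V₂₀` at `x^{1/3}` and `V` at `t`
  have hlog3 : Real.log (x ^ (1 / 3 : ℝ)) ≤ ℒ := by
    rw [Real.log_rpow hx0]; nlinarith
  have hlog30 : 0 ≤ Real.log (x ^ (1 / 3 : ℝ)) := Real.log_nonneg (by linarith)
  have hV17x : ∑ n ∈ Icc 1 ⌊x ^ (1 / 3 : ℝ)⌋₊, (σ 0 n : ℝ) ^ 17 / n ≤ C₁₇ * ℒ ^ (2 ^ 18 : ℕ) :=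
    (hV17 _ hx3').trans (by gcongr)
  have hV20x : ∑ n ∈ Icc 1 ⌊x ^ (1 / 3 : ℝ)⌋₊, (σ 0 n : ℝ) ^ 20 / n ≤ C₂₀ * ℒ ^ (2 ^ 21 : ℕ) :=
    (hV20 _ hx3').trans (by gcongr)
  set V : ℝ := C₃ * ℒ ^ 16 + 1 with hVdef
  have hV1 : V ≤ (C₃ + 1) * ℒ ^ 16 := by
    rw [hVdef, add_mul, one_mul]; linarith [one_le_pow₀ (n := 16) hℒ1]
  have hV0 : 0 ≤ V := by positivity
  have hVt : ∑ m ∈ Icc 1 ⌊t⌋₊, (σ 0 m : ℝ) ^ 3 / m ≤ V := by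
    by_cases ht2 : 2 ≤ ⌊t⌋₊
    · have ht0 : (2 : ℝ) ≤ ⌊t⌋₊ := by exact_mod_cast ht2
      have htpos : 0 < t := by
        by_contra h; rw [Nat.floor_of_nonpos (not_lt.mp h)] at ht2; omega
      have hlt : Real.log ⌊t⌋₊ ≤ ℒ :=
        Real.log_le_log (by linarith) ((Nat.floor_le htpos.le).trans htx)
      have hlt0 : 0 ≤ Real.log ⌊t⌋₊ := Real.log_nonneg (by linarith)
      calc ∑ m ∈ Icc 1 ⌊t⌋₊, (σ 0 m : ℝ) ^ 3 / m ≤ C₃ * Real.log ⌊t⌋₊ ^ (2 ^ (3 + 1)) := hV3 _ ht2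
        _ ≤ C₃ * ℒ ^ 16 := by norm_num; gcongr
        _ ≤ V := by rw [hVdef]; linarith
    · have hsub : Icc 1 ⌊t⌋₊ ⊆ {1} := fun m hm => by
        have := Finset.mem_Icc.mp hm; rw [Finset.mem_singleton]; omega
      calc ∑ m ∈ Icc 1 ⌊t⌋₊, (σ 0 m : ℝ) ^ 3 / m ≤ ∑ m ∈ ({1} : Finset ℕ), (σ 0 m : ℝ) ^ 3 / m :=
            Finset.sum_le_sum_of_subset_of_nonneg hsub fun m _ _ => by positivity
        _ = 1 := by simp
        _ ≤ V := by rw [hVdef]; linarith [mul_nonneg hC₃.le (pow_nonneg hℒ0.le 16)]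
  -- the structural bounds
  have hE := A.moebiusSq_E_le hsize h24 h26 htx hΛ1 hΛ₁1 hM hM₁ hVt (D₀ := D₀) (x := x)
  have hstruct := A.moebiusSq_levelSum_le_struct hsize h24 hx1 htx hD₀1 hD₀X Λ
  have hsizet := A.moebiusSq_size_sub_le_struct hsize h24 hx1 htx hD₀1 Λ (D₀ := D₀)
  -- Mertens-type bounds from (2.7)
  have hgD₀ : ∑ p ∈ Nat.primesLE D₀, g p ≤ Real.log ℒ + c' := by
    have h0 := sum_primesLE_density_le h27 hD₀2
    have hD₀0 : (1 : ℝ) < D₀ := by exact_mod_cast (by omega : 1 < D₀)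
    have h1 : Real.log (Real.log D₀) ≤ Real.log ℒ :=
      Real.log_le_log (Real.log_pos hD₀0) (Real.log_le_log (by linarith) hD₀x)
    linarith
  have hexpD₀ : Real.exp (∑ p ∈ Nat.primesLE D₀, g p) ≤ Real.exp c' * ℒ := by
    calc Real.exp (∑ p ∈ Nat.primesLE D₀, g p) ≤ Real.exp (Real.log ℒ + c') := Real.exp_le_exp.mpr hgD₀
      _ = Real.exp c' * ℒ := by rw [Real.exp_add, Real.exp_log hℒ0]; ring
  have hgM : ∑ p ∈ Nat.primesLE M, g p ≤ Real.log (2 * ℒ) + c' := by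
    have h0 := sum_primesLE_density_le h27 hM2
    have hM1 : (1 : ℝ) < M := by exact_mod_cast (by omega : 1 < M)
    have h1 : Real.log (Real.log M) ≤ Real.log (2 * ℒ) := by
      refine Real.log_le_log (Real.log_pos hM1) ?_
      calc Real.log M ≤ Real.log (x ^ 2) := Real.log_le_log (by linarith) hMx2
        _ = 2 * ℒ := by rw [Real.log_pow]; push_cast; ring
    linarith
  have hgM2 : ∑ p ∈ Nat.primesLE M, g (p ^ 2) ≤ K := by
    calc ∑ p ∈ Nat.primesLE M, g (p ^ 2) ≤ ∑ p ∈ Nat.primesLE M, K * ((p : ℝ) ^ 2)⁻¹ :=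
          Finset.sum_le_sum fun p hp => by
            rw [← div_eq_mul_inv]; exact h26 p (Nat.prime_of_mem_primesLE hp)
      _ = K * ∑ p ∈ Nat.primesLE M, ((p : ℝ) ^ 2)⁻¹ := (Finset.mul_sum _ _ _).symm
      _ ≤ K * 1 := mul_le_mul_of_nonneg_left (sum_primesLE_inv_sq_le_one M) hK
      _ = K := mul_one K
  have hEg : ∑ b ∈ (Icc 1 M).filter IsCubefree, (4 : ℝ) ^ b.primeFactors.card * g b ≤
      16 * Real.exp (4 * c' + 4 * K) * ℒ ^ 4 := by
    refine ((sum_cubefree_pow_mul_density_le hgm h24 (by norm_num) M).trans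
      (prod_one_add_density_le_exp h24 (by norm_num) M)).trans ?_
    calc Real.exp (4 * ∑ p ∈ Nat.primesLE M, g p + 4 * ∑ p ∈ Nat.primesLE M, g (p ^ 2))
        ≤ Real.exp (4 * (Real.log (2 * ℒ) + c') + 4 * K) := Real.exp_le_exp.mpr (by linarith [hgM, hgM2])
      _ = 16 * Real.exp (4 * c' + 4 * K) * ℒ ^ 4 := by
          rw [show 4 * (Real.log (2 * ℒ) + c') + 4 * K = (4 : ℕ) * Real.log (2 * ℒ) + (4 * c' + 4 * K)
            by push_cast; ring, Real.exp_add, ← Real.log_pow, Real.exp_log (by positivity)]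
          ring
  -- the moments `M₃`, `M₄`
  have hM3 : ∑ n ∈ Ioc 0 X, A.a n * (2 : ℝ) ^ (3 * n.primeFactors.card) ≤
      64 * K₈' * C₁₇ * ℒ ^ (2 ^ 18 : ℕ) * 𝒜 := by
    have h := A.sum_a_mul_two_pow_card_primeFactors_le 3 hx0.le h28x'
    rw [show 3 * 3 + 8 = 17 by norm_num] at h
    refine h.trans ?_
    calc (4 : ℝ) ^ 3 * K₈' * (∑ d ∈ Icc 1 ⌊x ^ (1 / 3 : ℝ)⌋₊, (σ 0 d : ℝ) ^ 17 / d) * A.size x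
        ≤ 4 ^ 3 * K₈' * (C₁₇ * ℒ ^ (2 ^ 18 : ℕ)) * A.size x := by gcongr
      _ = 64 * K₈' * C₁₇ * ℒ ^ (2 ^ 18 : ℕ) * 𝒜 := by norm_num; ring
  have hM4 : ∑ n ∈ Ioc 0 X, A.a n * (2 : ℝ) ^ (4 * n.primeFactors.card) ≤
      256 * K₈' * C₂₀ * ℒ ^ (2 ^ 21 : ℕ) * 𝒜 := by
    have h := A.sum_a_mul_two_pow_card_primeFactors_le 4 hx0.le h28x'
    rw [show 3 * 4 + 8 = 20 by norm_num] at h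
    refine h.trans ?_
    calc (4 : ℝ) ^ 4 * K₈' * (∑ d ∈ Icc 1 ⌊x ^ (1 / 3 : ℝ)⌋₊, (σ 0 d : ℝ) ^ 20 / d) * A.size x
        ≤ 4 ^ 4 * K₈' * (C₂₀ * ℒ ^ (2 ^ 21 : ℕ)) * A.size x := by gcongr
      _ = 256 * K₈' * C₂₀ * ℒ ^ (2 ^ 21 : ℕ) * 𝒜 := by norm_num; ring
  -- `∑_{n ≤ t} a_n² ≤ (𝒜/(c₂ x^{1/3}))²` by (2.2)
  have hx13 : 0 < x ^ (1 / 3 : ℝ) := by positivity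
  have ha2 : ∑ n ∈ Ioc 0 ⌊t⌋₊, A.a n ^ 2 ≤ (𝒜 / (c₂ * x ^ (1 / 3 : ℝ))) ^ 2 := by
    have hsq : Real.sqrt (∑ n ∈ Icc 1 X, A.a n ^ 2) ≤ 𝒜 / (c₂ * x ^ (1 / 3 : ℝ)) := by
      rw [le_div_iff₀ (by positivity)]
      calc Real.sqrt (∑ n ∈ Icc 1 X, A.a n ^ 2) * (c₂ * x ^ (1 / 3 : ℝ))
          = c₂ * x ^ (1 / 3 : ℝ) * Real.sqrt (∑ n ∈ Icc 1 X, A.a n ^ 2) := by ring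
        _ ≤ 𝒜 := h22x
    have h0 : 0 ≤ ∑ n ∈ Icc 1 X, A.a n ^ 2 := Finset.sum_nonneg fun n _ => sq_nonneg _
    calc ∑ n ∈ Ioc 0 ⌊t⌋₊, A.a n ^ 2 ≤ ∑ n ∈ Icc 1 X, A.a n ^ 2 := by
          refine Finset.sum_le_sum_of_subset_of_nonneg (fun n hn => ?_) fun n _ _ => sq_nonneg _
          have hn' := Finset.mem_Ioc.mp hn
          have := Nat.floor_mono htx
          exact Finset.mem_Icc.mpr ⟨hn'.1, hn'.2.trans this⟩
      _ = Real.sqrt (∑ n ∈ Icc 1 X, A.a n ^ 2) ^ 2 := (Real.sq_sqrt h0).symm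
      _ ≤ (𝒜 / (c₂ * x ^ (1 / 3 : ℝ))) ^ 2 := pow_le_pow_left₀ (Real.sqrt_nonneg _) hsq 2
  have htfloor : (⌊t⌋₊ : ℝ) ≤ x := by
    rcases le_or_gt 0 t with ht | ht
    · exact (Nat.floor_le ht).trans htx
    · rw [Nat.floor_of_nonpos ht.le]; simp; linarith
  -- `1/Λ^{3/4} ≤ 2/ℒ^{3·2^22}`
  have hΛ34 : ℒ ^ (3 * 2 ^ 22 : ℕ) / 2 ≤ (Λ : ℝ) ^ (3 / 4 : ℝ) := by
    have h1 : (L / 2) ^ (3 / 4 : ℝ) ≤ (Λ : ℝ) ^ (3 / 4 : ℝ) :=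
      Real.rpow_le_rpow (by positivity) hΛge (by norm_num)
    refine le_trans ?_ h1
    rw [Real.div_rpow hL0.le (by norm_num), hL34]
    refine div_le_div_of_nonneg_left (by positivity) (by positivity) ?_
    calc (2 : ℝ) ^ (3 / 4 : ℝ) ≤ 2 ^ (1 : ℝ) := Real.rpow_le_rpow_of_exponent_le one_le_two (by norm_num)
      _ = 2 := Real.rpow_one 2
  have hΛ34' : 1 / (Λ : ℝ) ^ (3 / 4 : ℝ) ≤ 2 / ℒ ^ (3 * 2 ^ 22 : ℕ) := by
    rw [div_le_div_iff₀ (Real.rpow_pos_of_pos hΛ0 _) (by positivity)]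
    linarith
  -- the targets
  set P : ℝ := ℒ ^ (2 ^ 22 + 2 : ℕ) with hPdef
  have hP0 : 0 < P := pow_pos hℒ0 _
  have hP2 : P ^ 2 = ℒ ^ (2 ^ 23 + 4 : ℕ) := by rw [hPdef, ← pow_mul]; norm_num
  have hB0 : 0 ≤ 𝒜 / (4 * P) := by positivity
  have hBsq : (𝒜 / (4 * P)) ^ 2 = 𝒜 ^ 2 * (1 / ℒ ^ (2 ^ 23 + 4 : ℕ)) / 16 := by
    rw [div_pow, mul_pow, hP2]; ring
  have hκ₁' : κ₁ = 8 * (Real.exp (2 * K * C₅) * Real.exp c') := by rw [hκ₁, Real.exp_add]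
  ---------------------------------------------------------------- term 1: the density tail
  have hT1 : A.congrSum 1 x * (Real.exp (2 * K * C₅) / (Λ : ℝ) ^ (3 / 4 : ℝ) *
      Real.exp (∑ p ∈ Nat.primesLE D₀, g p)) ≤ 𝒜 / (4 * P) := by
    have h2 : κ₁ * ℒ ^ 1 / ℒ ^ (3 * 2 ^ 22 : ℕ) ≤ 1 / ℒ ^ (2 ^ 22 + 2 : ℕ) :=
      const_mul_pow_div_pow_le hℒ1 hℒκ₁ (by norm_num)
    calc A.congrSum 1 x * (Real.exp (2 * K * C₅) / (Λ : ℝ) ^ (3 / 4 : ℝ) *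
          Real.exp (∑ p ∈ Nat.primesLE D₀, g p))
        = 𝒜 * (Real.exp (2 * K * C₅) * (1 / (Λ : ℝ) ^ (3 / 4 : ℝ)) *
            Real.exp (∑ p ∈ Nat.primesLE D₀, g p)) := by rw [h𝒜eq]; ring
      _ ≤ 𝒜 * (Real.exp (2 * K * C₅) * (2 / ℒ ^ (3 * 2 ^ 22 : ℕ)) * (Real.exp c' * ℒ)) := by gcongr
      _ = 𝒜 * (κ₁ * ℒ ^ 1 / ℒ ^ (3 * 2 ^ 22 : ℕ)) / 4 := by rw [hκ₁']; ring
      _ ≤ 𝒜 * (1 / ℒ ^ (2 ^ 22 + 2 : ℕ)) / 4 := by gcongr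
      _ = 𝒜 / (4 * P) := by rw [hPdef]; ring
  ---------------------------------------------------------------- term 2: `RS` (`E₁`)
  have hT2 : Real.sqrt ((∑ n ∈ Ioc 0 X, A.a n * (2 : ℝ) ^ (4 * n.primeFactors.card) +
        A.congrSum 1 x * ∑ b ∈ (Icc 1 M).filter IsCubefree, (4 : ℝ) ^ b.primeFactors.card * g b) *
      ∑ b ∈ (Icc 1 M).filter IsCubefree, |A.remainder b t|) ≤ 𝒜 / (4 * P) := by
    refine (Real.sqrt_le_sqrt ?_).trans (le_of_eq (Real.sqrt_sq hB0))
    have hR : ∑ b ∈ (Icc 1 M).filter IsCubefree, |A.remainder b t| ≤ 𝒜 / ℒ ^ (2 ^ 25 : ℕ) := by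
      rw [← hL2eq]; exact hRt
    have hR0 : 0 ≤ ∑ b ∈ (Icc 1 M).filter IsCubefree, |A.remainder b t| :=
      Finset.sum_nonneg fun b _ => abs_nonneg _
    have hℒ4 : ℒ ^ 4 ≤ ℒ ^ (2 ^ 21 : ℕ) := pow_le_pow_right₀ hℒ1 (by norm_num)
    have hfirst : ∑ n ∈ Ioc 0 X, A.a n * (2 : ℝ) ^ (4 * n.primeFactors.card) +
        A.congrSum 1 x * ∑ b ∈ (Icc 1 M).filter IsCubefree, (4 : ℝ) ^ b.primeFactors.card * g b ≤
        (κ₂ / 16) * ℒ ^ (2 ^ 21 : ℕ) * 𝒜 := by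
      rw [← h𝒜eq]
      calc ∑ n ∈ Ioc 0 X, A.a n * (2 : ℝ) ^ (4 * n.primeFactors.card) +
            𝒜 * ∑ b ∈ (Icc 1 M).filter IsCubefree, (4 : ℝ) ^ b.primeFactors.card * g b
          ≤ 256 * K₈' * C₂₀ * ℒ ^ (2 ^ 21 : ℕ) * 𝒜 + 𝒜 * (16 * Real.exp (4 * c' + 4 * K) * ℒ ^ 4) :=
            add_le_add hM4 (mul_le_mul_of_nonneg_left hEg h𝒜0)
        _ ≤ 256 * K₈' * C₂₀ * ℒ ^ (2 ^ 21 : ℕ) * 𝒜 +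
              𝒜 * (16 * Real.exp (4 * c' + 4 * K) * ℒ ^ (2 ^ 21 : ℕ)) := by gcongr
        _ = (κ₂ / 16) * ℒ ^ (2 ^ 21 : ℕ) * 𝒜 := by rw [hκ₂]; ring
    have hfirst0 : 0 ≤ (κ₂ / 16) * ℒ ^ (2 ^ 21 : ℕ) * 𝒜 := by positivity
    have h2 : κ₂ * ℒ ^ (2 ^ 21 : ℕ) / ℒ ^ (2 ^ 25 : ℕ) ≤ 1 / ℒ ^ (2 ^ 23 + 4 : ℕ) :=
      const_mul_pow_div_pow_le hℒ1 hℒκ₂ (by norm_num)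
    calc _ ≤ (κ₂ / 16) * ℒ ^ (2 ^ 21 : ℕ) * 𝒜 * (𝒜 / ℒ ^ (2 ^ 25 : ℕ)) :=
          mul_le_mul hfirst hR hR0 hfirst0
      _ = 𝒜 ^ 2 * (κ₂ * ℒ ^ (2 ^ 21 : ℕ) / ℒ ^ (2 ^ 25 : ℕ)) / 16 := by ring
      _ ≤ 𝒜 ^ 2 * (1 / ℒ ^ (2 ^ 23 + 4 : ℕ)) / 16 := by gcongr
      _ = (𝒜 / (4 * P)) ^ 2 := hBsq.symm
  ---------------------------------------------------------------- term 3: the middle range (`E₂₂`)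
  have hT3 : Real.sqrt ((A.congrSum 1 x * (Real.exp (K * C₅) / (Λ : ℝ) ^ (3 / 4 : ℝ)) +
        ∑ b ∈ (Icc 1 M).filter IsCubefree, |A.remainder b x|) *
      ∑ n ∈ Ioc 0 X, A.a n * (2 : ℝ) ^ (3 * n.primeFactors.card)) ≤ 𝒜 / (4 * P) := by
    refine (Real.sqrt_le_sqrt ?_).trans (le_of_eq (Real.sqrt_sq hB0))
    have hR : ∑ b ∈ (Icc 1 M).filter IsCubefree, |A.remainder b x| ≤ 𝒜 / ℒ ^ (3 * 2 ^ 22 : ℕ) := by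
      have : 𝒜 / L ^ 2 ≤ 𝒜 / ℒ ^ (3 * 2 ^ 22 : ℕ) := by
        rw [hL2eq]
        exact div_le_div_of_nonneg_left h𝒜0 (by positivity) (pow_le_pow_right₀ hℒ1 (by norm_num))
      exact hRx.trans this
    have hfirst : A.congrSum 1 x * (Real.exp (K * C₅) / (Λ : ℝ) ^ (3 / 4 : ℝ)) +
        ∑ b ∈ (Icc 1 M).filter IsCubefree, |A.remainder b x| ≤
        𝒜 * (2 * Real.exp (K * C₅) + 1) / ℒ ^ (3 * 2 ^ 22 : ℕ) := by
      rw [← h𝒜eq]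
      calc 𝒜 * (Real.exp (K * C₅) / (Λ : ℝ) ^ (3 / 4 : ℝ)) +
            ∑ b ∈ (Icc 1 M).filter IsCubefree, |A.remainder b x|
          = 𝒜 * (Real.exp (K * C₅) * (1 / (Λ : ℝ) ^ (3 / 4 : ℝ))) +
            ∑ b ∈ (Icc 1 M).filter IsCubefree, |A.remainder b x| := by ring
        _ ≤ 𝒜 * (Real.exp (K * C₅) * (2 / ℒ ^ (3 * 2 ^ 22 : ℕ))) + 𝒜 / ℒ ^ (3 * 2 ^ 22 : ℕ) := by
            gcongr
        _ = 𝒜 * (2 * Real.exp (K * C₅) + 1) / ℒ ^ (3 * 2 ^ 22 : ℕ) := by ring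
    have hfirst0 : 0 ≤ 𝒜 * (2 * Real.exp (K * C₅) + 1) / ℒ ^ (3 * 2 ^ 22 : ℕ) := by positivity
    have hM30 : 0 ≤ ∑ n ∈ Ioc 0 X, A.a n * (2 : ℝ) ^ (3 * n.primeFactors.card) :=
      Finset.sum_nonneg fun n _ => mul_nonneg (A.a_nonneg n) (by positivity)
    have h2 : κ₃ * ℒ ^ (2 ^ 18 : ℕ) / ℒ ^ (3 * 2 ^ 22 : ℕ) ≤ 1 / ℒ ^ (2 ^ 23 + 4 : ℕ) :=
      const_mul_pow_div_pow_le hℒ1 hℒκ₃ (by norm_num)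
    calc _ ≤ 𝒜 * (2 * Real.exp (K * C₅) + 1) / ℒ ^ (3 * 2 ^ 22 : ℕ) *
          (64 * K₈' * C₁₇ * ℒ ^ (2 ^ 18 : ℕ) * 𝒜) := mul_le_mul hfirst hM3 hM30 hfirst0
      _ = 𝒜 ^ 2 * (κ₃ * ℒ ^ (2 ^ 18 : ℕ) / ℒ ^ (3 * 2 ^ 22 : ℕ)) / 16 := by rw [hκ₃]; ring
      _ ≤ 𝒜 ^ 2 * (1 / ℒ ^ (2 ^ 23 + 4 : ℕ)) / 16 := by gcongr
      _ = (𝒜 / (4 * P)) ^ 2 := hBsq.symm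
  ---------------------------------------------------------------- term 4: the large range (`E₂₁`)
  have hT4 : Real.sqrt ((∑ n ∈ Ioc 0 ⌊t⌋₊, A.a n ^ 2) * (⌊t⌋₊ * V ^ 2 / Λ₁)) ≤ 𝒜 / (4 * P) := by
    refine (Real.sqrt_le_sqrt ?_).trans (le_of_eq (Real.sqrt_sq hB0))
    set y : ℝ := x ^ (1 / 3 : ℝ) with hy
    have hy0 : 0 < y := hx13
    have hxy : x = y ^ (3 : ℕ) := by
      rw [hy, ← Real.rpow_natCast, ← Real.rpow_mul hx0.le]; norm_num
    have hV2 : V ^ 2 ≤ ((C₃ + 1) * ℒ ^ 16) ^ 2 := pow_le_pow_left₀ hV0 hV1 2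
    have hsecond : (⌊t⌋₊ : ℝ) * V ^ 2 / Λ₁ ≤ y ^ (3 : ℕ) * ((C₃ + 1) * ℒ ^ 16) ^ 2 / (L * y / 2) := by
      refine div_le_div₀ ?_ ?_ (by positivity) hΛ₁ge
      · exact mul_nonneg (pow_nonneg hy0.le 3) (sq_nonneg _)
      · rw [← hxy]; exact mul_le_mul htfloor hV2 (sq_nonneg _) hx0.le
    have hsecond0 : 0 ≤ (⌊t⌋₊ : ℝ) * V ^ 2 / Λ₁ :=
      div_nonneg (mul_nonneg (Nat.cast_nonneg _) (sq_nonneg _)) (Nat.cast_nonneg _)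
    have ha20 : 0 ≤ ∑ n ∈ Ioc 0 ⌊t⌋₊, A.a n ^ 2 := Finset.sum_nonneg fun n _ => sq_nonneg _
    have h2 : κ₄ * ℒ ^ (32 : ℕ) / ℒ ^ (2 ^ 24 : ℕ) ≤ 1 / ℒ ^ (2 ^ 23 + 4 : ℕ) :=
      const_mul_pow_div_pow_le hℒ1 hℒκ₄ (by norm_num)
    calc (∑ n ∈ Ioc 0 ⌊t⌋₊, A.a n ^ 2) * (⌊t⌋₊ * V ^ 2 / Λ₁)
        ≤ (𝒜 / (c₂ * y)) ^ 2 * (y ^ (3 : ℕ) * ((C₃ + 1) * ℒ ^ 16) ^ 2 / (L * y / 2)) :=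
          mul_le_mul ha2 hsecond hsecond0 (sq_nonneg _)
      _ = 𝒜 ^ 2 * (κ₄ * ℒ ^ (32 : ℕ) / ℒ ^ (2 ^ 24 : ℕ)) / 16 := by
          rw [hκ₄, hLdef]
          field_simp
      _ ≤ 𝒜 ^ 2 * (1 / ℒ ^ (2 ^ 23 + 4 : ℕ)) / 16 := by gcongr
      _ = (𝒜 / (4 * P)) ^ 2 := hBsq.symm
  ---------------------------------------------------------------- assembling
  have hEle : A.congrSum 1 t * ∑ d ∈ (Icc 1 D₀).filter Squarefree,
        ∑ L ∈ (Nat.primesLE X).powerset with ¬(∏ p ∈ L, p) ≤ Λ, g (Nat.lcm d ((∏ p ∈ L, p) ^ 2)) +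
      ∑ d ∈ (Icc 1 D₀).filter Squarefree,
        ∑ L ∈ (Nat.primesLE X).powerset with (∏ p ∈ L, p) ≤ Λ,
          |A.remainder (Nat.lcm d ((∏ p ∈ L, p) ^ 2)) t| +
      ∑ d ∈ (Icc 1 D₀).filter Squarefree,
        ∑ L ∈ (Nat.primesLE X).powerset with ¬(∏ p ∈ L, p) ≤ Λ,
          A.congrSum (Nat.lcm d ((∏ p ∈ L, p) ^ 2)) t ≤ 𝒜 / P := by
    refine hE.trans ?_
    have : 𝒜 / (4 * P) + 𝒜 / (4 * P) + 𝒜 / (4 * P) + 𝒜 / (4 * P) = 𝒜 / P := by ring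
    rw [← this]
    exact add_le_add (add_le_add (add_le_add hT1 hT2) hT3) hT4
  have hGfac : 1 + ∑ d ∈ (Icc 1 D₀).filter Squarefree, moebiusSqDensity g d ≤ 2 * Real.exp c' * ℒ := by
    have h1 : ∑ d ∈ (Icc 1 D₀).filter Squarefree, moebiusSqDensity g d ≤ Real.exp c' * ℒ :=
      ((A.sum_squarefree_moebiusSqDensity_le h24 D₀).trans (A.sum_squarefree_density_le_exp h24 D₀)).trans
        hexpD₀
    have h2 : 1 ≤ Real.exp c' * ℒ := one_le_mul_of_one_le_of_one_le (Real.one_le_exp hc'0) hℒ1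
    linarith
  have hE0 : 0 ≤ 𝒜 / P := by positivity
  have hG0 : 0 ≤ 1 + ∑ d ∈ (Icc 1 D₀).filter Squarefree, moebiusSqDensity g d :=
    add_nonneg zero_le_one (Finset.sum_nonneg fun d _ => moebiusSqDensity_nonneg hgm h24 d)
  constructor
  · calc _ ≤ _ := hstruct
      _ ≤ (1 + ∑ d ∈ (Icc 1 D₀).filter Squarefree, moebiusSqDensity g d) * (𝒜 / P) :=
          mul_le_mul_of_nonneg_left hEle hG0
      _ ≤ (2 * Real.exp c' * ℒ) * (𝒜 / P) := mul_le_mul_of_nonneg_right hGfac hE0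
      _ = 2 * Real.exp c' * 𝒜 / ℒ ^ (2 ^ 22 + 1) := by
          rw [hPdef, pow_succ]
          field_simp
  · rw [hsize t]
    exact hsizet.trans hEle

end SieveSequence

end Literature.NumberTheory.Sieve
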